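import Mathlib
import HarnessLib
import Summits.KontsevichZagierPeriods.Statement
import Literature.NumberTheory.Transcendental.KZProductIdeal
import Literature.NumberTheory.Transcendental.KZKernelConjectureForms
import Literature.NumberTheory.Transcendental.KZCubeRationalMoves
import Literature.NumberTheory.Transcendental.KZLogCalculusProofs
import Literature.NumberTheory.Transcendental.KZFibreMapMove

/-!
# The ZETA2 stratum (15 census pairs among R1..R6 ∈ π²ℚ) DECIDED in `KZ.relations` (route `RootDecompQuadraticDescent`, instances of crux stmt-KontsevichZagierPeriods-28994 / stmt-4280) · part 1/5

Cell `decomp-kz`, lens 6 (decomp-kz-lens-6 g8b): ENGINE v3.1 — the bounded «triangle calculus» on sub-graph representations `SB(c;L,U)` (`sb_cut/affine/swap/unfold/add′`, `rel_opn/scale/shift/powB` ⟹ `sb_pow`; `rel_scale` over the OPEN base via `KZ.of_sub_of_mem_relations_of_affine`) decides every pair #23 #34 #35 #38–#49 of the cell census as an INTEGER relation (normal forms R1≡2A, R2≡4A−4W, R3≡2A−T, R4≡4W−2T, R5≡2W+2T, R6≡3W, 2T≡A, 3W≡2A); packaged `zetaTwoStratum_descentTwoQ_instances` and `zetaTwoPair_of_kzDimTwo`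 BY NAME.

Source: `HOME/decomp-kz-lens-6/g8/ZetaTwoPairs.lean` sha256 a8aac2aea5cc880c (1299 l; critic decomp-kz-crit-1 g2 CLEARED 2026-08-30T09:03:21Z, std axioms), split into 5 modules by the landing seat decomp-kz-census-1 g7 (contexts re-opened per part; generic docstrings added where the source had none; the route file is imported only by the last part, which proves the `KZDimTwo` corollaries BY NAME).  No `sorry`; standard axioms.  References: [cite: KontsevichZagier2001, §1.2].
-/

noncomputable section

open MeasureTheory Set MvPolynomial

namespace Summit.KontsevichZagierPeriods.RootDecompQuadraticDescent.ZetaTwoPairs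

open Literature.NumberTheory.Transcendental
open Literature.NumberTheory.Transcendental.KZ
open Literature.ModelTheory.ExponentialFields (IsSemialgebraic)

/-! ## §1 Small `Fin` bookkeeping and intervals (verbatim from `SurdPairs.lean`) -/

/-- `snoc2_zero`: auxiliary theorem of the lens-6 development «zeta2» (instances of 28994/4280) — see the module docstring; verbatim from the lens file. -/
@[simp] private theorem snoc2_zero (x : Fin 1 → ℝ) (t : ℝ) : (Fin.snoc x t : Fin 2 → ℝ) 0 = x 0 := rfl
/-- `snoc2_one`: auxiliary theorem of the lens-6 development «zeta2» (instances of 28994/4280) — see the module docstring; verbatim from the lens file. -/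
@[simp] private theorem snoc2_one (x : Fin 1 → ℝ) (t : ℝ) : (Fin.snoc x t : Fin 2 → ℝ) 1 = t := rfl
/-- `init2_zero`: auxiliary theorem of the lens-6 development «zeta2» (instances of 28994/4280) — see the module docstring; verbatim from the lens file. -/
@[simp] private theorem init2_zero (z : Fin 2 → ℝ) : Fin.init z 0 = z 0 := rfl
/-- `last_one_eq`: auxiliary theorem of the lens-6 development «zeta2» (instances of 28994/4280) — see the module docstring; verbatim from the lens file. -/
private theorem last_one_eq : (Fin.last 1 : Fin 2) = 1 := rfl

/-- A regular rational function gives a KZ-rational representation. [folklore] -/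
private theorem isRational_rep {M : ℕ} (T : RFun M) : T.rep.IsRational :=
  ⟨T.num, T.den, T.den_ne, fun _ _ => rfl⟩

/-- The interval `[a, b]` as a subset of `ℝ¹`. -/
def ivl (a b : ℚ) : Set (Fin 1 → ℝ) := {y | (a : ℝ) ≤ y 0 ∧ y 0 ≤ b}

/-- `mem_ivl`: auxiliary theorem of the lens-6 development «zeta2» (instances of 28994/4280) — see the module docstring; verbatim from the lens file. -/
theorem mem_ivl {a b : ℚ} {y : Fin 1 → ℝ} : y ∈ ivl a b ↔ (a : ℝ) ≤ y 0 ∧ y 0 ≤ b := Iff.rfl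

/-- `I01`: auxiliary theorem of the lens-6 development «zeta2» (instances of 28994/4280) — see the module docstring; verbatim from the lens file. -/
theorem I01 {y : Fin 1 → ℝ} (hy : y ∈ ivl 0 1) : y 0 ∈ Icc (0 : ℝ) 1 := by
  simpa [mem_ivl] using hy

/-- `isSemialgebraic_ivl`: auxiliary theorem of the lens-6 development «zeta2» (instances of 28994/4280) — see the module docstring; verbatim from the lens file. -/
theorem isSemialgebraic_ivl (a b : ℚ) : IsSemialgebraic ℚ (ivl a b) := by
  have h1 := Literature.ModelTheory.ExponentialFields.isSemialgebraic_setOf_eval_le (k := ℚ) (R := ℝ)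
    (C a : MvPolynomial (Fin 1) ℚ) (X 0)
  have h2 := Literature.ModelTheory.ExponentialFields.isSemialgebraic_setOf_eval_le (k := ℚ) (R := ℝ)
    (X 0 : MvPolynomial (Fin 1) ℚ) (C b)
  have h := h1.inter h2
  simp only [MvPolynomial.aeval_C, MvPolynomial.aeval_X, eq_ratCast] at h
  have hset : ivl a b = {y : Fin 1 → ℝ | (a : ℝ) ≤ y 0} ∩ {y | y 0 ≤ (b : ℝ)} := by
    ext y; simp [ivl]
  rw [hset]
  exact h

/-! ## §2 Engine v3: edges and the bounded sub-graph representations `SB` -/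

/-- A `ℚ`-semialgebraic continuous NONNEGATIVE edge function `σ = f(t)` over `[0,1]`. -/
structure Edge where
  f : ℝ → ℝ
  sa : IsSemialgebraicFunOn ℚ (ivl 0 1) (fun y => f (y 0))
  nonneg : ∀ t ∈ Icc (0 : ℝ) 1, 0 ≤ f t
  cont : ContinuousOn f (Icc (0 : ℝ) 1)

/-- `Edge.exists_bound`: auxiliary theorem of the lens-6 development «zeta2» (instances of 28994/4280) — see the module docstring; verbatim from the lens file. -/
theorem Edge.exists_bound (E : Edge) : ∃ M, ∀ t ∈ Icc (0 : ℝ) 1, E.f t ≤ M := by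
  obtain ⟨C, hC⟩ := isCompact_Icc.exists_bound_of_continuousOn E.cont
  exact ⟨C, fun t ht => (le_abs_self _).trans (by simpa using hC t ht)⟩

/-- An edge given on `[0,1]` by a quotient of polynomials. -/
def mkEdge (f : ℝ → ℝ) (P Q : MvPolynomial (Fin 1) ℚ) (hQ : ∀ y ∈ ivl 0 1, aeval y Q ≠ 0)
    (hPQ : ∀ y ∈ ivl 0 1, aeval y P / aeval y Q = f (y 0)) (h0 : ∀ t ∈ Icc (0 : ℝ) 1, 0 ≤ f t)
    (hc : ContinuousOn f (Icc (0 : ℝ) 1)) : Edge :=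
  ⟨f, (isSemialgebraicFunOn_aeval_div_aeval (isSemialgebraic_ivl 0 1) P Q hQ).congr hPQ, h0, hc⟩

/-- `mkEdge_f`: auxiliary theorem of the lens-6 development «zeta2» (instances of 28994/4280) — see the module docstring; verbatim from the lens file. -/
@[simp] theorem mkEdge_f (f : ℝ → ℝ) (P Q hQ hPQ h0 hc) : (mkEdge f P Q hQ hPQ h0 hc).f = f := rfl

/-- The sub-graph domain `{(t, σ) : 0 ≤ t ≤ 1, L(t) ≤ σ ≤ U(t)}`. -/
def sbDom (L U : Edge) : Set (Fin 2 → ℝ) :=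
  KZlog.band (ivl 0 1) (fun y => L.f (y 0)) (fun y => U.f (y 0))

/-- `mem_sbDom`: auxiliary theorem of the lens-6 development «zeta2» (instances of 28994/4280) — see the module docstring; verbatim from the lens file. -/
theorem mem_sbDom {L U : Edge} {z : Fin 2 → ℝ} :
    z ∈ sbDom L U ↔ ((0 : ℝ) ≤ z 0 ∧ z 0 ≤ 1) ∧ L.f (z 0) ≤ z 1 ∧ z 1 ≤ U.f (z 0) := by
  show (Fin.init z ∈ ivl 0 1 ∧ L.f (Fin.init z 0) ≤ z (Fin.last 1) ∧
    z (Fin.last 1) ≤ U.f (Fin.init z 0)) ↔ _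
  rw [mem_ivl]
  simp only [init2_zero, last_one_eq, Rat.cast_zero, Rat.cast_one]

/-- `isSemialgebraic_sbDom`: auxiliary theorem of the lens-6 development «zeta2» (instances of 28994/4280) — see the module docstring; verbatim from the lens file. -/
theorem isSemialgebraic_sbDom (L U : Edge) : IsSemialgebraic ℚ (sbDom L U) :=
  KZlog.isSemialgebraic_band L.sa U.sa

/-- `sbDom_subset_Icc`: auxiliary theorem of the lens-6 development «zeta2» (instances of 28994/4280) — see the module docstring; verbatim from the lens file. -/
theorem sbDom_subset_Icc {L U : Edge} {M : ℝ} (hM : ∀ t ∈ Icc (0 : ℝ) 1, U.f t ≤ M) :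
    sbDom L U ⊆ Icc ![(0 : ℝ), 0] ![(1 : ℝ), M] := by
  intro z hz
  rcases mem_sbDom.1 hz with ⟨⟨h1, h2⟩, h3, h4⟩
  have h5 : 0 ≤ z 1 := (L.nonneg _ ⟨h1, h2⟩).trans h3
  refine ⟨fun i => ?_, fun i => ?_⟩ <;> fin_cases i
  · simpa using h1
  · simpa using h5
  · simpa using h2
  · simpa using h4.trans (hM _ ⟨h1, h2⟩)

/-- `volume_sbDom_lt_top`: auxiliary theorem of the lens-6 development «zeta2» (instances of 28994/4280) — see the module docstring; verbatim from the lens file. -/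
theorem volume_sbDom_lt_top (L U : Edge) : volume (sbDom L U) < ⊤ := by
  obtain ⟨M, hM⟩ := U.exists_bound
  exact (measure_mono (sbDom_subset_Icc (L := L) hM)).trans_lt measure_Icc_lt_top

/-- On the sub-graph domain `1 + tσ ≥ 1`. -/
theorem one_le_den {L U : Edge} {z : Fin 2 → ℝ} (hz : z ∈ sbDom L U) : 1 ≤ 1 + z 0 * z 1 := by
  rcases mem_sbDom.1 hz with ⟨⟨h1, h2⟩, h3, _⟩
  have h5 : 0 ≤ z 1 := (L.nonneg _ ⟨h1, h2⟩).trans h3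
  nlinarith [mul_nonneg h1 h5]

/-- `den_pos`: auxiliary theorem of the lens-6 development «zeta2» (instances of 28994/4280) — see the module docstring; verbatim from the lens file. -/
theorem den_pos {L U : Edge} {z : Fin 2 → ℝ} (hz : z ∈ sbDom L U) : 0 < 1 + z 0 * z 1 :=
  lt_of_lt_of_le one_pos (one_le_den hz)

/-- `isSemialgebraicFunOn_sb`: auxiliary theorem of the lens-6 development «zeta2» (instances of 28994/4280) — see the module docstring; verbatim from the lens file. -/
theorem isSemialgebraicFunOn_sb (c : ℚ) (L U : Edge) :
    IsSemialgebraicFunOn ℚ (sbDom L U) (fun z => (c : ℝ) / (1 + z 0 * z 1)) := by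
  refine (isSemialgebraicFunOn_aeval_div_aeval (isSemialgebraic_sbDom L U) (C c) (1 + X 0 * X 1)
    fun z hz => ?_).congr fun z _ => ?_
  · simp only [map_add, map_one, map_mul, aeval_X]
    exact (den_pos hz).ne'
  · simp only [map_add, map_one, map_mul, aeval_X, aeval_C, eq_ratCast]

/-- `continuousOn_sb`: auxiliary theorem of the lens-6 development «zeta2» (instances of 28994/4280) — see the module docstring; verbatim from the lens file. -/
theorem continuousOn_sb (c : ℚ) (L U : Edge) :
    ContinuousOn (fun z : Fin 2 → ℝ => (c : ℝ) / (1 + z 0 * z 1)) (sbDom L U) := by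
  refine ContinuousOn.div continuousOn_const (Continuous.continuousOn (by fun_prop)) fun z hz => ?_
  exact (den_pos hz).ne'

/-- **`SB(c; L, U) = [ {0 ≤ t ≤ 1, L(t) ≤ σ ≤ U(t)}, c dσ dt / (1 + tσ) ]`** — the bounded form of
`∫₀¹ (log(1 + t U) − log(1 + t L)) dt/t`. -/
def SB (c : ℚ) (L U : Edge) : KZ.IntegralRep 2 where
  domain := sbDom L U
  integrand z := (c : ℝ) / (1 + z 0 * z 1)
  isSemialgebraic_domain := isSemialgebraic_sbDom L U
  isSemialgebraicFunOn_integrand := isSemialgebraicFunOn_sb c L U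
  integrableOn := by
    have hB := isSemialgebraic_sbDom L U
    refine IntegrableOn.of_bound (volume_sbDom_lt_top L U)
      ((continuousOn_sb c L U).aestronglyMeasurable (IsSemialgebraic.measurableSet_holds hB)) |(c : ℝ)| ?_
    refine (ae_restrict_iff' (IsSemialgebraic.measurableSet_holds hB)).2 (ae_of_all _ fun z hz => ?_)
    rw [Real.norm_eq_abs, abs_div, abs_of_pos (den_pos hz)]
    exact div_le_self (abs_nonneg _) (one_le_den hz)

/-- `SB_domain`: auxiliary theorem of the lens-6 development «zeta2» (instances of 28994/4280) — see the module docstring; verbatim from the lens file. -/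
@[simp] theorem SB_domain (c : ℚ) (L U : Edge) : (SB c L U).domain = sbDom L U := rfl
/-- `SB_integrand`: auxiliary theorem of the lens-6 development «zeta2» (instances of 28994/4280) — see the module docstring; verbatim from the lens file. -/
@[simp] theorem SB_integrand (c : ℚ) (L U : Edge) (z : Fin 2 → ℝ) :
    (SB c L U).integrand z = (c : ℝ) / (1 + z 0 * z 1) := rfl

/-! ## §3 Engine v3: the moves -/

/-- **(cut)** additivity along the rational curve `σ = M(t)` (rule 1a; the two pieces meet in the
graph of `M`, a null set by `KZ.volume_graph_eq_zero`). -/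
theorem sb_cut (c : ℚ) (L M U : Edge) (hLM : ∀ t ∈ Icc (0 : ℝ) 1, L.f t ≤ M.f t)
    (hMU : ∀ t ∈ Icc (0 : ℝ) 1, M.f t ≤ U.f t) :
    KZ.of (SB c L U) - KZ.of (SB c L M) - KZ.of (SB c M U) ∈ KZ.relations := by
  refine KZ.domainAddRel_subset_relations ⟨2, SB c L U, SB c L M, SB c M U, ?_, ?_,
    fun z _ => rfl, fun z _ => rfl, rfl⟩
  · ext z
    simp only [SB_domain, mem_union, mem_sbDom]
    constructor
    · rintro ⟨h0, h1, h2⟩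
      rcases le_total (z 1) (M.f (z 0)) with h | h
      · exact Or.inl ⟨h0, h1, h⟩
      · exact Or.inr ⟨h0, h, h2⟩
    · rintro (⟨h0, h1, h2⟩ | ⟨h0, h1, h2⟩)
      · exact ⟨h0, h1, h2.trans (hMU _ h0)⟩
      · exact ⟨h0, (hLM _ h0).trans h1, h2⟩
  · refine measure_mono_null (fun z hz => ?_) (KZ.volume_graph_eq_zero M.sa)
    have h1 : z ∈ sbDom L M := hz.1
    have h2 : z ∈ sbDom M U := hz.2
    refine ⟨h1.1, ?_⟩
    show z (Fin.last 1) = M.f (Fin.init z 0)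
    exact le_antisymm h1.2.2 h2.2.1

/-- Two `SB`'s whose edges agree on `[0,1]` are congruent. -/
theorem sb_congr (c : ℚ) (L L' U U' : Edge) (hL : ∀ t ∈ Icc (0 : ℝ) 1, L.f t = L'.f t)
    (hU : ∀ t ∈ Icc (0 : ℝ) 1, U.f t = U'.f t) :
    KZ.of (SB c L U) - KZ.of (SB c L' U') ∈ KZ.relations :=
  KZ.of_sub_of_mem_relations_of_eqOn (by
    ext z
    simp only [SB_domain, mem_sbDom]
    constructor
    · rintro ⟨h0, h1, h2⟩; exact ⟨h0, (hL _ h0) ▸ h1, (hU _ h0) ▸ h2⟩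
    · rintro ⟨h0, h1, h2⟩; exact ⟨h0, (hL _ h0).symm ▸ h1, (hU _ h0).symm ▸ h2⟩) fun z _ => rfl

/-- The edges `0`, `1`, `t`. -/
def zeroE : Edge := mkEdge (fun _ => 0) 0 1 (fun y _ => by simp) (fun y _ => by simp)
  (fun _ _ => le_rfl) continuousOn_const
/-- `oneE`: auxiliary def of the lens-6 development «zeta2» (instances of 28994/4280) — see the module docstring; verbatim from the lens file. -/
def oneE : Edge := mkEdge (fun _ => 1) 1 1 (fun y _ => by simp) (fun y _ => by simp)
  (fun _ _ => zero_le_one) continuousOn_const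
/-- `idE`: auxiliary def of the lens-6 development «zeta2» (instances of 28994/4280) — see the module docstring; verbatim from the lens file. -/
def idE : Edge := mkEdge (fun t => t) (X 0) 1 (fun y _ => by simp) (fun y _ => by simp)
  (fun _ ht => ht.1) continuousOn_id

/-- `zeroE_f`: auxiliary theorem of the lens-6 development «zeta2» (instances of 28994/4280) — see the module docstring; verbatim from the lens file. -/
@[simp] theorem zeroE_f (t : ℝ) : zeroE.f t = 0 := rfl
/-- `oneE_f`: auxiliary theorem of the lens-6 development «zeta2» (instances of 28994/4280) — see the module docstring; verbatim from the lens file. -/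
@[simp] theorem oneE_f (t : ℝ) : oneE.f t = 1 := rfl
/-- `idE_f`: auxiliary theorem of the lens-6 development «zeta2» (instances of 28994/4280) — see the module docstring; verbatim from the lens file. -/
@[simp] theorem idE_f (t : ℝ) : idE.f t = t := rfl

/-- **(aff)** the fibrewise affine substitution `σ = M(t) + (1 + t·M(t))·τ` (rule 2, Literature
`KZ.of_sub_of_mem_relations_of_fibreMap`): `SB(c; 0, U') ≡ SB(c; M, U)` whenever
`U = M + (1 + t M)·U'` on `[0,1]` — the multiplicativity `B(φψ) − B(φ) = B(ψ)` with `φ = 1 + tM`. -/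
theorem sb_affine (c : ℚ) (M U U' : Edge) (hMd : Differentiable ℝ M.f)
    (hU : ∀ t ∈ Icc (0 : ℝ) 1, U.f t = M.f t + (1 + t * M.f t) * U'.f t) :
    KZ.of (SB c zeroE U') - KZ.of (SB c M U) ∈ KZ.relations := by
  have hB := isSemialgebraic_sbDom zeroE U'
  have hz0 : ∀ z ∈ sbDom zeroE U', z 0 ∈ Icc (0 : ℝ) 1 := fun z hz => (mem_sbDom.1 hz).1
  have hz1 : ∀ z ∈ sbDom zeroE U', 0 ≤ z 1 := fun z hz => by
    have h := (mem_sbDom.1 hz).2.1; simpa using h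
  have hφ : ∀ z ∈ sbDom zeroE U', 0 < 1 + z 0 * M.f (z 0) := fun z hz => by
    have h0 := (hz0 z hz).1
    have hM := M.nonneg _ (hz0 z hz)
    nlinarith [mul_nonneg h0 hM]
  refine of_sub_of_mem_relations_of_fibreMap (G := ivl 0 1) (a := fun y => zeroE.f (y 0))
    (b := fun y => U'.f (y 0)) (a' := fun y => M.f (y 0)) (b' := fun y => U.f (y 0))
    (fun z => M.f (z 0) + (1 + z 0 * M.f (z 0)) * z 1) (fun z => 1 + z 0 * M.f (z 0))
    (SB c zeroE U') (SB c M U) rfl rfl (fun y hy => ?_) ?_ ?_ ?_ ?_ ?_ ?_ ?_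
  · simpa using U'.nonneg _ (I01 hy)
  · -- `ψ` is `ℚ`-semialgebraic on the domain
    have hM : IsSemialgebraicFunOn ℚ (sbDom zeroE U') (fun z : Fin 2 → ℝ => M.f (Fin.init z 0)) :=
      M.sa.comp_init_mono hB fun z hz => hz.1
    have h0 : IsSemialgebraicFunOn ℚ (sbDom zeroE U') (fun z : Fin 2 → ℝ => z 0) := by
      simpa using isSemialgebraicFunOn_aeval hB (X 0 : MvPolynomial (Fin 2) ℚ)
    have h1 : IsSemialgebraicFunOn ℚ (sbDom zeroE U') (fun z : Fin 2 → ℝ => z 1) := by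
      simpa using isSemialgebraicFunOn_aeval hB (X 1 : MvPolynomial (Fin 2) ℚ)
    have hone : IsSemialgebraicFunOn ℚ (sbDom zeroE U') (fun _ : Fin 2 → ℝ => (1 : ℝ)) := by
      simpa using isSemialgebraicFunOn_ratCast hB 1
    exact (IsSemialgebraicFunOn.add_holds hM (IsSemialgebraicFunOn.mul_holds
      (IsSemialgebraicFunOn.add_holds hone (IsSemialgebraicFunOn.mul_holds h0 hM)) h1)).congr
      fun z _ => by simp only [Pi.add_apply, Pi.mul_apply, init2_zero]
  · -- differentiable
    intro z _
    fun_prop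
  · -- derivative along the fibre
    intro z _
    show HasDerivAt (fun t => M.f ((Fin.snoc (Fin.init z) t : Fin 2 → ℝ) 0) +
      (1 + (Fin.snoc (Fin.init z) t : Fin 2 → ℝ) 0 * M.f ((Fin.snoc (Fin.init z) t : Fin 2 → ℝ) 0)) *
        (Fin.snoc (Fin.init z) t : Fin 2 → ℝ) 1) _ (z 1)
    simp only [snoc2_zero, snoc2_one, init2_zero]
    exact (((hasDerivAt_id' (z 1)).const_mul (1 + z 0 * M.f (z 0))).const_add (M.f (z 0))).congr_deriv
      (by ring)
  · -- positive fibre derivative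
    intro z hz
    exact hφ z hz
  · -- lower edge `τ = 0 ↦ σ = M`
    intro y _
    show M.f ((Fin.snoc y (zeroE.f (y 0)) : Fin 2 → ℝ) 0) +
      (1 + (Fin.snoc y (zeroE.f (y 0)) : Fin 2 → ℝ) 0 * M.f ((Fin.snoc y (zeroE.f (y 0)) : Fin 2 → ℝ) 0)) *
        (Fin.snoc y (zeroE.f (y 0)) : Fin 2 → ℝ) 1 = M.f (y 0)
    simp only [snoc2_zero, snoc2_one, zeroE_f, mul_zero, add_zero]
  · -- upper edge `τ = U' ↦ σ = U`
    intro y hy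
    show M.f ((Fin.snoc y (U'.f (y 0)) : Fin 2 → ℝ) 0) +
      (1 + (Fin.snoc y (U'.f (y 0)) : Fin 2 → ℝ) 0 * M.f ((Fin.snoc y (U'.f (y 0)) : Fin 2 → ℝ) 0)) *
        (Fin.snoc y (U'.f (y 0)) : Fin 2 → ℝ) 1 = U.f (y 0)
    simp only [snoc2_zero, snoc2_one]
    exact (hU _ (I01 hy)).symm
  · -- integrands: `c/(1+tτ) = c/(1+tσ) · (1+tM)` at `σ = M + (1+tM)τ`
    intro z hz
    have hzc : z ∈ sbDom zeroE U' := hz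
    have h1 := (den_pos hzc).ne'
    have h2 := (hφ z hzc).ne'
    rw [SB_integrand, SB_integrand]
    simp only [snoc2_zero, snoc2_one, init2_zero]
    have h3 : 1 + z 0 * (M.f (z 0) + (1 + z 0 * M.f (z 0)) * z 1) =
        (1 + z 0 * M.f (z 0)) * (1 + z 0 * z 1) := by ring
    rw [h3]
    field_simp

/-- **(swap)** `t ↔ σ` carries the lower triangle `{0 ≤ σ ≤ t}` onto the upper one `{t ≤ σ ≤ 1}`;
the integrand `c/(1+tσ)` is symmetric (rule 2, `KZ.of_sub_of_reindex_mem_relations`). -/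
theorem sb_swap (c : ℚ) : KZ.of (SB c zeroE idE) - KZ.of (SB c idE oneE) ∈ KZ.relations := by
  have h1 := KZ.of_sub_of_reindex_mem_relations (SB c zeroE idE) (Equiv.swap (0 : Fin 2) 1)
  have h2 : KZ.of ((SB c zeroE idE).reindex (Equiv.swap (0 : Fin 2) 1)) - KZ.of (SB c idE oneE) ∈
      KZ.relations := by
    refine KZ.of_sub_of_mem_relations_of_eqOn ?_ fun w _ => ?_
    · ext w
      rw [KZ.IntegralRep.reindex_domain, mem_setOf_eq, SB_domain, SB_domain, mem_sbDom, mem_sbDom]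
      simp only [Equiv.swap_apply_left, Equiv.swap_apply_right, zeroE_f, idE_f, oneE_f]
      constructor
      · rintro ⟨⟨h1, h2⟩, h3, h4⟩; exact ⟨⟨h1.trans h3, h4⟩, h1, h3⟩
      · rintro ⟨⟨h1, h2⟩, h3, h4⟩; exact ⟨⟨h3, h4.trans h2⟩, h4, h2⟩
    · simp only [KZ.IntegralRep.reindex_integrand, SB_integrand, Equiv.swap_apply_left,
        Equiv.swap_apply_right, mul_comm (w 1) (w 0)]
  have : KZ.of (SB c zeroE idE) - KZ.of (SB c idE oneE) =
      (KZ.of (SB c zeroE idE) - KZ.of ((SB c zeroE idE).reindex (Equiv.swap (0 : Fin 2) 1))) +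
      (KZ.of ((SB c zeroE idE).reindex (Equiv.swap (0 : Fin 2) 1)) - KZ.of (SB c idE oneE)) := by abel
  rw [this]
  exact add_mem h1 h2

end Summit.KontsevichZagierPeriods.RootDecompQuadraticDescent.ZetaTwoPairs

end
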